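import Mathlib
import HarnessLib
import Literature.Dynamics.TransferOperators.MayerTransferOperatorExistence
import Summits.RiemannHypothesis.Statement
import Summits.RiemannHypothesis.RiemannHypothesis.Theses.MayerPairing
import Summits.RiemannHypothesis.RiemannHypothesis.Theorems.MayerPairingMayerSumHalfPlane

/-!
# RiemannHypothesis / MayerPairing — the inlined eigenvalue predicate IS Mayer's point spectrum

Route `RiemannHypothesis/MayerPairing`, helper file for item stmt-RiemannHypothesis-1473
(`Target = UnitCircleCrossedOnce ∧ BranchPairing`). Every item of the route inlines, verbatim, the
ζ-free predicate "`μ` is an eigenvalue of Mayer's continued transfer operator `L_s`" in the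
Lewis–Zagier/Chang–Mayer three-term form: `∃ f` holomorphic on a half-plane `Re z > -δ` (`δ > 0`),
`f ≢ 0` on `Re z > 0`, `μ (f z - f (z+1)) = (z+1)^{-2s} f(1/(z+1))`, and
`μ f x - f 0 (x+1)^{1-2s}/(2s-1) → 0` as the real `x → +∞`. The planner, three route reviewers and
the grounder asserted informally that this is exactly the nonzero point spectrum of `L_s` on
`B(D)` (translation risk K3 of the card). This file PROVES it against the Literature's operator
`Literature.Dynamics.TransferOperators.mayerTransfer s : B(D) →L[ℂ] B(D)`, for all `0 < Re s`,
`s ≠ 1/2`: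

* `mayerPairing_isEigen_of_eigenvector` — an eigenvector `g ≠ 0`, `L_s g = μ g`, `μ ≠ 0`, gives a
  solution `f = μ⁻¹ L_s g` (Mayer's formula on `Re z > -1/2`, `δ = 1/2`);
* `mayerPairing_eigenvector_of_isEigen` — a solution `f` gives `μ ≠ 0` and an eigenvector: extend
  `f` to `Re z > -1 ⊇ D̄` by the three-term equation, restrict to `B(D)`; the periodic function
  `c = μ f - L_s f` on `Re z > -1/2` tends to `0` along the reals by the two normalisations, hence
  vanishes (identity theorem);
* `mayerPairing_isEigen_iff` — the audit: predicate(s, μ) ↔ (`μ ≠ 0 ∧ ∃ g ≠ 0, L_s g = μ • g`);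
* `mayerPairing_eisensteinEigenvalueOne_iff_changMayer` — the dictionary item 1469 is literally
  the Literature's named fact `ChangMayerEigenvalueOne`;
* `mayerPairing_unitCircleCrossedOnce_iff_operator`, `mayerPairing_branchPairing_iff_operator`,
  `mayerPairing_target_iff_operator` — items 1470, 1471, 1473 restated in operator language
  (continuous selections of nonzero eigenvalues of `L_{σ+iτ}` on `B(D)`).

References: C.-H. Chang, D. Mayer, Contemp. Math. 290 (2001) 1–40, (2.46)–(2.49), (3.21)–(3.23),
Prop. 4.2; D. Mayer, Comm. Math. Phys. 130 (1990) 311–333, Thm. 5; J. Lewis, D. Zagier, Ann. Math.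
153 (2001), Ch. IV.
-/

namespace Summit.RiemannHypothesis.RiemannHypothesis.Theorems

open Filter Topology Metric Set Complex
open scoped Real
open Literature.Dynamics.TransferOperators
open Summit.RiemannHypothesis.RiemannHypothesis.Theses.MayerPairing

/-! ### Part 1. Eigenvectors of `L_s` satisfy the predicate -/

/-- An element of `B(D)` vanishing at the real points of `(0, 2)` is zero. [folklore] -/
theorem mayerPairing_eq_zero_of_real_zeros {g : MayerSpace}
    (h : ∀ x : ℝ, 0 < x → x < 2 → g.toFun x = 0) : g = 0 := by
  have hD : ∀ z ∈ mayerDisc, g.toFun z = 0 :=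
    mayerPairing_eqOn_zero_of_real_zeros isOpen_mayerDisc (convex_ball _ _).isPreconnected
      g.differentiableOn_toFun zero_lt_two
      (fun x hx hx' => mayerPairing_ofReal_mem_mayerDisc (by linarith) (by linarith)) h
  have hcl : EqOn g.toFun (fun _ => (0 : ℂ)) mayerClosedDisc :=
    (show EqOn g.toFun (fun _ => (0 : ℂ)) mayerDisc from hD).of_subset_closure g.continuousOn_toFun
      continuousOn_const mayerDisc_subset_mayerClosedDisc (by rw [closure_mayerDisc])
  refine MayerSpace.ext fun z hz => ?_
  rw [hcl hz]
  simp [MayerSpace.toFun]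

/-- Point values of an eigenvector: `(L_s g)(z) = μ g(z)` on the closed disc. [folklore] -/
theorem mayerPairing_mayerSum₀_eq_of_eigenvector {s μ : ℂ} (hs : 0 < s.re) (hs' : s ≠ 1 / 2)
    {g : MayerSpace} (heig : mayerTransfer s g = μ • g) {z : ℂ} (hz : z ∈ mayerClosedDisc) :
    mayerSum₀ s g.toFun z = μ * g.toFun z := by
  have h := mayerTransfer_toFun_apply_of_re_pos hs hs' g ⟨z, hz⟩
  rw [heig, MayerSpace.toFun_smul] at h
  simpa using h.symm

/-- **Eigenvectors give solutions of the three-term problem.** If `μ ≠ 0` and `g ∈ B(D)`,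
`g ≠ 0`, `L_s g = μ g` (`0 < Re s`, `s ≠ 1/2`), then `f := μ⁻¹ L_s g` — the extension of `g` to the
half-plane `Re z > -1/2` by Mayer's formula — satisfies the route's inlined eigenvalue predicate
with `δ = 1/2`: holomorphy, non-vanishing on `Re z > 0`, the three-term functional equation
`μ (f z - f (z+1)) = (z+1)^{-2s} f(1/(z+1))`, and the normalisation
`μ f x - f 0 (x+1)^{1-2s}/(2s-1) → 0`. [cite: ChangMayer2001, (2.46)–(2.48) and (3.21)–(3.23)] -/
theorem mayerPairing_isEigen_of_eigenvector {s μ : ℂ} (hs : 0 < s.re) (hs' : s ≠ 1 / 2)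
    (hμ : μ ≠ 0) {g : MayerSpace} (hg : g ≠ 0) (heig : mayerTransfer s g = μ • g) :
    ∃ f : ℂ → ℂ, ∃ δ : ℝ, 0 < δ ∧ DifferentiableOn ℂ f {z : ℂ | -δ < z.re} ∧
      (∃ z : ℂ, 0 < z.re ∧ f z ≠ 0) ∧
      (∀ z : ℂ, -δ < z.re → μ * (f z - f (z + 1)) = (z + 1) ^ (-(2 * s)) * f (1 / (z + 1))) ∧
      Tendsto (fun x : ℝ => μ * f x - f 0 * ((x : ℂ) + 1) ^ (1 - 2 * s) / (2 * s - 1))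
        atTop (𝓝 0) := by
  set f : ℂ → ℂ := fun z => μ⁻¹ * mayerSum₀ s g.toFun z with hf
  -- `f = g` on the closed disc
  have hfg : ∀ z ∈ mayerClosedDisc, f z = g.toFun z := fun z hz => by
    rw [hf]
    simp only []
    rw [mayerPairing_mayerSum₀_eq_of_eigenvector hs hs' heig hz, ← mul_assoc, inv_mul_cancel₀ hμ,
      one_mul]
  refine ⟨f, 1 / 2, by norm_num, ?_, ?_, ?_, ?_⟩
  · exact (differentiableOn_const _).mul (mayerPairing_differentiableOn_mayerSum₀ hs hs' g)
  · -- non-vanishing on the open right half-plane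
    by_contra hcon
    have hcon' : ∀ z : ℂ, 0 < z.re → f z = 0 := fun z hz => by
      by_contra h
      exact hcon ⟨z, hz, h⟩
    refine hg (mayerPairing_eq_zero_of_real_zeros fun x hx hx2 => ?_)
    have hxD : (x : ℂ) ∈ mayerClosedDisc :=
      mayerDisc_subset_mayerClosedDisc (mayerPairing_ofReal_mem_mayerDisc (by linarith) (by linarith))
    rw [← hfg x hxD]
    exact hcon' x (by simpa using hx)
  · -- the three-term functional equation
    intro z hz
    have hz' : -(1 / 2 : ℝ) ≤ z.re := le_of_lt hz
    have hmem := mayerPairing_one_div_add_one_mem hz'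
    rw [hfg _ hmem, hf]
    simp only []
    rw [← mul_sub, ← mul_assoc, mul_inv_cancel₀ hμ, one_mul]
    exact mayerPairing_mayerSum₀_sub_mayerSum₀_add_one hs hs' g hz'
  · -- the normalisation
    have h0 : f 0 = g.toFun 0 := hfg 0 zero_mem_mayerClosedDisc
    refine (mayerPairing_tendsto_mayerSum₀_normalisation hs hs' g).congr' ?_
    filter_upwards with x
    rw [h0, hf]
    simp only []
    rw [← mul_assoc, mul_inv_cancel₀ hμ, one_mul]

/-! ### Part 2. Solutions of the three-term problem give eigenvectors -/

/-- **Solutions of the three-term problem give eigenvectors.** Let `0 < Re s`, `s ≠ 1/2`, and let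
`F` satisfy the route's inlined eigenvalue predicate for `μ`: holomorphic on `Re z > -δ` (`δ > 0`),
not identically zero on `Re z > 0`, `μ (F z - F (z+1)) = (z+1)^{-2s} F(1/(z+1))` there, and
`μ F x - F 0 (x+1)^{1-2s}/(2s-1) → 0` along the reals. Then `μ ≠ 0`, and the function
`F̃ z = F (z+1) + μ⁻¹ (z+1)^{-2s} F (1/(z+1))` (`= F` where both live; holomorphic on `Re z > -1 ⊇ D̄`)
restricts to a nonzero `g ∈ B(D)` with `L_s g = μ g`. Mechanism: `c := μ F̃ - L_s g` is holomorphic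
and `1`-periodic on `Re z > -1/2` (three-term equation against the telescoping of Mayer's sum) and
tends to `0` along the reals (the two normalisations), hence vanishes.
[cite: ChangMayer2001, (3.21)–(3.23) and Prop. 4.2] -/
theorem mayerPairing_eigenvector_of_isEigen {s μ : ℂ} (hs : 0 < s.re) (hs' : s ≠ 1 / 2)
    {F : ℂ → ℂ} {δ : ℝ} (hδ : 0 < δ) (hF : DifferentiableOn ℂ F {z : ℂ | -δ < z.re})
    (hnz : ∃ z : ℂ, 0 < z.re ∧ F z ≠ 0)
    (hfe : ∀ z : ℂ, -δ < z.re → μ * (F z - F (z + 1)) = (z + 1) ^ (-(2 * s)) * F (1 / (z + 1)))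
    (hlim : Tendsto (fun x : ℝ => μ * F x - F 0 * ((x : ℂ) + 1) ^ (1 - 2 * s) / (2 * s - 1))
      atTop (𝓝 0)) :
    μ ≠ 0 ∧ ∃ g : MayerSpace, g ≠ 0 ∧ mayerTransfer s g = μ • g ∧
      ∀ z ∈ mayerClosedDisc, -δ < z.re → g.toFun z = F z := by
  -- the half-plane of `F` is open and convex; `F` is not identically zero on `(0, 1) ⊂ ℝ`
  have hUo : IsOpen {z : ℂ | -δ < z.re} := isOpen_lt continuous_const Complex.continuous_re
  have hUc : IsPreconnected {z : ℂ | -δ < z.re} := (convex_halfSpace_re_gt _).isPreconnected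
  have hUmem : ∀ x : ℝ, 0 < x → x < 1 → (x : ℂ) ∈ {z : ℂ | -δ < z.re} := fun x hx _ => by
    show -δ < (x : ℂ).re
    simp only [ofReal_re]
    linarith
  have hF01 : ¬ ∀ x : ℝ, 0 < x → x < 1 → F x = 0 := by
    intro h
    obtain ⟨z₀, hz₀, hFz₀⟩ := hnz
    exact hFz₀ (mayerPairing_eqOn_zero_of_real_zeros hUo hUc hF zero_lt_one hUmem h z₀
      (show -δ < z₀.re by linarith))
  -- Step 1: `μ ≠ 0` (else `F ∘ (1/(·+1))` vanishes on `[0, ∞)`, i.e. `F = 0` on `(0, 1]`)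
  have hμ : μ ≠ 0 := by
    intro hμ0
    refine hF01 fun t ht0 ht1 => ?_
    have ht' : 1 < 1 / t := by rw [lt_div_iff₀ ht0]; linarith
    have hx : -δ < (((1 / t - 1 : ℝ)) : ℂ).re := by
      simp only [ofReal_re]
      linarith
    have h := hfe _ hx
    rw [hμ0, zero_mul] at h
    have hx1 : (((1 / t - 1 : ℝ)) : ℂ) + 1 = ((1 / t : ℝ) : ℂ) := by push_cast; ring
    rw [hx1] at h
    have ht0' : ((1 / t : ℝ) : ℂ) ≠ 0 := by exact_mod_cast (one_div_pos.2 ht0).ne'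
    have hpow : ((1 / t : ℝ) : ℂ) ^ (-(2 * s)) ≠ 0 := by
      rw [Ne, cpow_eq_zero_iff, not_and_or]
      exact Or.inl ht0'
    have hF0 := (mul_eq_zero.1 h.symm).resolve_left hpow
    have e : 1 / ((1 / t : ℝ) : ℂ) = (t : ℂ) := by
      push_cast
      rw [one_div_one_div]
    rwa [e] at hF0
  -- Step 2: the extension `F̃` to `Re z > -1`
  set Ft : ℂ → ℂ := fun z => F (z + 1) + μ⁻¹ * ((z + 1) ^ (-(2 * s)) * F (1 / (z + 1))) with hFt
  have hFt_eq : ∀ z : ℂ, -δ < z.re → Ft z = F z := fun z hz => by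
    have h := hfe z hz
    show F (z + 1) + μ⁻¹ * ((z + 1) ^ (-(2 * s)) * F (1 / (z + 1))) = F z
    rw [← h]
    field_simp
    ring
  have hQre : ∀ z ∈ {z : ℂ | (-1 : ℝ) < z.re}, 0 < (z + 1).re := fun z hz => by
    have hz' : (-1 : ℝ) < z.re := hz
    simp only [add_re, one_re]
    linarith
  have hFt_diff : DifferentiableOn ℂ Ft {z : ℂ | (-1 : ℝ) < z.re} := by
    have hA : DifferentiableOn ℂ (fun z => F (z + 1)) {z : ℂ | (-1 : ℝ) < z.re} :=
      hF.comp (differentiableOn_id.add_const 1) fun z hz => by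
        show -δ < (z + 1).re
        linarith [hQre z hz]
    have hne : ∀ z ∈ {z : ℂ | (-1 : ℝ) < z.re}, z + 1 ≠ 0 := fun z hz h0 => by
      have h := hQre z hz
      rw [h0, zero_re] at h
      exact lt_irrefl _ h
    have hB : DifferentiableOn ℂ (fun z : ℂ => (z + 1) ^ (-(2 * s))) {z : ℂ | (-1 : ℝ) < z.re} :=
      (differentiableOn_id.add_const 1).cpow_const fun z hz =>
        mem_slitPlane_iff.mpr (Or.inl (hQre z hz))
    have hC : DifferentiableOn ℂ (fun z => F (1 / (z + 1))) {z : ℂ | (-1 : ℝ) < z.re} :=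
      hF.comp ((differentiableOn_const 1).div (differentiableOn_id.add_const 1) hne) fun z hz => by
        show -δ < (1 / (z + 1)).re
        linarith [mayerPairing_one_div_re_pos (hQre z hz)]
    exact hA.add ((differentiableOn_const _).mul (hB.mul hC))
  -- the three-term equation for `F̃` on `Re z > -1`
  have hFt_fe : ∀ z : ℂ, (-1 : ℝ) < z.re →
      μ * (Ft z - Ft (z + 1)) = (z + 1) ^ (-(2 * s)) * Ft (1 / (z + 1)) := by
    intro z hz
    have hz0 : 0 < (z + 1).re := hQre z hz
    have hz1 : -δ < (z + 1).re := by linarith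
    have h1 := hfe (z + 1) hz1
    have hw : -δ < (1 / (z + 1)).re := by linarith [mayerPairing_one_div_re_pos hz0]
    rw [hFt_eq _ hw]
    show μ * (F (z + 1) + μ⁻¹ * ((z + 1) ^ (-(2 * s)) * F (1 / (z + 1))) -
        (F (z + 1 + 1) + μ⁻¹ * ((z + 1 + 1) ^ (-(2 * s)) * F (1 / (z + 1 + 1))))) =
      (z + 1) ^ (-(2 * s)) * F (1 / (z + 1))
    have key : μ * (F (z + 1) + μ⁻¹ * ((z + 1) ^ (-(2 * s)) * F (1 / (z + 1))) -
        (F (z + 1 + 1) + μ⁻¹ * ((z + 1 + 1) ^ (-(2 * s)) * F (1 / (z + 1 + 1))))) =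
        μ * (F (z + 1) - F (z + 1 + 1)) + μ * μ⁻¹ * ((z + 1) ^ (-(2 * s)) * F (1 / (z + 1))) -
          μ * μ⁻¹ * ((z + 1 + 1) ^ (-(2 * s)) * F (1 / (z + 1 + 1))) := by ring
    rw [key, h1, mul_inv_cancel₀ hμ]
    ring
  -- Step 3: the element `g ∈ B(D)`
  have hQD : mayerClosedDisc ⊆ {z : ℂ | (-1 : ℝ) < z.re} := mayerClosedDisc_subset_halfPlane
  set g : MayerSpace := MayerSpace.mk Ft (hFt_diff.continuousOn.mono hQD)
    (hFt_diff.mono (mayerDisc_subset_mayerClosedDisc.trans hQD)) with hgdef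
  have hg_apply : ∀ z ∈ mayerClosedDisc, g.toFun z = Ft z := fun z hz =>
    MayerSpace.mk_toFun_apply _ _ _ hz
  -- Step 4: the periodic function `c = μ F̃ - L_s g` on `Re z > -1/2`
  set C : ℂ → ℂ := fun z => μ * Ft z - mayerSum₀ s g.toFun z with hCdef
  have hPQ : {z : ℂ | -(1 / 2 : ℝ) < z.re} ⊆ {z : ℂ | (-1 : ℝ) < z.re} := fun z hz => by
    have hz' : -(1 / 2 : ℝ) < z.re := hz
    show (-1 : ℝ) < z.re
    linarith
  have hC_diff : DifferentiableOn ℂ C {z : ℂ | -(1 / 2 : ℝ) < z.re} :=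
    ((differentiableOn_const _).mul (hFt_diff.mono hPQ)).sub
      (mayerPairing_differentiableOn_mayerSum₀ hs hs' g)
  have hC_per : ∀ z : ℂ, -(1 / 2 : ℝ) < z.re → C (z + 1) = C z := by
    intro z hz
    have hD := mayerPairing_one_div_add_one_mem hz.le
    have e1 := mayerPairing_mayerSum₀_sub_mayerSum₀_add_one hs hs' g hz.le
    have e2 := hFt_fe z (by linarith)
    rw [hg_apply _ hD] at e1
    show μ * Ft (z + 1) - mayerSum₀ s g.toFun (z + 1) = μ * Ft z - mayerSum₀ s g.toFun z
    linear_combination e1 - e2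
  have hC_lim : Tendsto (fun x : ℝ => C x) atTop (𝓝 0) := by
    have hg0 : g.toFun 0 = F 0 := by
      rw [hg_apply 0 zero_mem_mayerClosedDisc, hFt_eq 0 (by simpa using hδ)]
    have h := hlim.sub (mayerPairing_tendsto_mayerSum₀_normalisation hs hs' g)
    rw [sub_zero] at h
    refine h.congr' ?_
    filter_upwards [eventually_gt_atTop (0 : ℝ)] with x hx
    have hxF : Ft x = F x := hFt_eq x (by simp only [ofReal_re]; linarith)
    show μ * F x - F 0 * ((x : ℂ) + 1) ^ (1 - 2 * s) / (2 * s - 1) -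
        (mayerSum₀ s g.toFun x - g.toFun 0 * ((x : ℂ) + 1) ^ (1 - 2 * s) / (2 * s - 1)) =
      μ * Ft x - mayerSum₀ s g.toFun x
    rw [hg0, hxF]
    ring
  have hC0 := mayerPairing_eq_zero_of_periodic_of_tendsto hC_diff hC_per hC_lim
  -- Step 5: the eigenvalue equation on the closed disc
  have hEq : EqOn (mayerSum₀ s g.toFun) (fun z => μ * Ft z) mayerClosedDisc := by
    have hS : EqOn (mayerSum₀ s g.toFun) (fun z => μ * Ft z) mayerDisc := fun z hz => by
      have h := hC0 z (mayerPairing_re_gt_of_mem_mayerDisc hz)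
      change μ * Ft z - mayerSum₀ s g.toFun z = 0 at h
      show mayerSum₀ s g.toFun z = μ * Ft z
      linear_combination -h
    exact hS.of_subset_closure (continuousOn_mayerSum₀ hs hs' g)
      (continuousOn_const.mul (hFt_diff.continuousOn.mono hQD)) mayerDisc_subset_mayerClosedDisc
      (by rw [closure_mayerDisc])
  have heig : mayerTransfer s g = μ • g := MayerSpace.ext fun z hz => by
    rw [mayerTransfer_toFun_apply_of_re_pos hs hs' g ⟨z, hz⟩, MayerSpace.toFun_smul, Pi.smul_apply,
      smul_eq_mul, hg_apply z hz]
    exact hEq hz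
  -- Step 6: `g ≠ 0` and `g = F` on the closed disc
  have hg_F : ∀ z ∈ mayerClosedDisc, -δ < z.re → g.toFun z = F z := fun z hz hzδ => by
    rw [hg_apply z hz, hFt_eq z hzδ]
  have hg_ne : g ≠ 0 := by
    intro h0
    refine hF01 fun x hx0 hx1 => ?_
    have hxD : (x : ℂ) ∈ mayerClosedDisc :=
      mayerDisc_subset_mayerClosedDisc (mayerPairing_ofReal_mem_mayerDisc (by linarith) (by linarith))
    rw [← hg_F x hxD (by simp only [ofReal_re]; linarith), h0]
    simp [MayerSpace.toFun]
  exact ⟨hμ, g, hg_ne, heig, hg_F⟩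

/-! ### Part 3. The predicate audit and its route-level corollaries -/

/-- **The route's inlined eigenvalue predicate IS the nonzero point spectrum of Mayer's `L_s`.**
For `0 < Re s`, `s ≠ 1/2` and `μ ∈ ℂ`: there is a function `f`, holomorphic on some half-plane
`Re z > -δ` (`δ > 0`), not identically zero on `Re z > 0`, with
`μ (f z - f (z+1)) = (z+1)^{-2s} f(1/(z+1))` and `μ f x - f 0 (x+1)^{1-2s}/(2s-1) → 0` along the
reals — the clause inlined verbatim in every item of route MayerPairing — if and only if `μ ≠ 0`
and `μ` is an eigenvalue of Mayer's transfer operator `L_s` on the Banach space `B(D)`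
(`Literature.Dynamics.TransferOperators.mayerTransfer`). [cite: ChangMayer2001, Prop. 4.2 and (3.21)–(3.23)] -/
theorem mayerPairing_isEigen_iff {s μ : ℂ} (hs : 0 < s.re) (hs' : s ≠ 1 / 2) :
    (∃ f : ℂ → ℂ, ∃ δ : ℝ, 0 < δ ∧ DifferentiableOn ℂ f {z : ℂ | -δ < z.re} ∧
        (∃ z : ℂ, 0 < z.re ∧ f z ≠ 0) ∧
        (∀ z : ℂ, -δ < z.re → μ * (f z - f (z + 1)) = (z + 1) ^ (-(2 * s)) * f (1 / (z + 1))) ∧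
        Tendsto (fun x : ℝ => μ * f x - f 0 * ((x : ℂ) + 1) ^ (1 - 2 * s) / (2 * s - 1))
          atTop (𝓝 0)) ↔
      (μ ≠ 0 ∧ ∃ g : MayerSpace, g ≠ 0 ∧ mayerTransfer s g = μ • g) := by
  constructor
  · rintro ⟨f, δ, hδ, hF, hnz, hfe, hlim⟩
    obtain ⟨hμ, g, hg, heig, -⟩ := mayerPairing_eigenvector_of_isEigen hs hs' hδ hF hnz hfe hlim
    exact ⟨hμ, g, hg, heig⟩
  · rintro ⟨hμ, g, hg, heig⟩
    exact mayerPairing_isEigen_of_eigenvector hs hs' hμ hg heig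

/-- **The route's dictionary item IS the Literature's named fact**: `EisensteinEigenvalueOne`
(item 1469, inlined three-term form) is equivalent to `ChangMayerEigenvalueOne` ("`1` is an
eigenvalue of `L_β` on `B(D)` at the zeros of `ζ(2β)`, `0 < Re β < 1/2`"), the form proved in
`Literature.Dynamics.TransferOperators.ChangMayerEigenfunction`. This retires the route's
translation risk K3 formally. [folklore] -/
theorem mayerPairing_eisensteinEigenvalueOne_iff_changMayer :
    EisensteinEigenvalueOne ↔ ChangMayerEigenvalueOne := by
  constructor
  · intro h β h0 h1 hζ
    have hβ : β ≠ 1 / 2 := fun e => by rw [e] at h1; norm_num at h1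
    obtain ⟨-, g, hg, heig⟩ := (mayerPairing_isEigen_iff h0 hβ).1 (h β h0 h1 hζ)
    exact ⟨g, hg, by rw [heig, one_smul]⟩
  · intro h s h0 h1 hζ
    have hs : s ≠ 1 / 2 := fun e => by rw [e] at h1; norm_num at h1
    obtain ⟨g, hg, heig⟩ := h s h0 h1 hζ
    exact (mayerPairing_isEigen_iff h0 hs).2 ⟨one_ne_zero, g, hg, by rw [heig, one_smul]⟩

/-- Parameters on a horizontal segment of the half-strip: `s = σ + iτ` with `0 < σ < 1/2` has
`0 < Re s` and `s ≠ 1/2`. [folklore] -/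
theorem mayerPairing_param_ok {σ τ : ℝ} (h0 : 0 < σ) (h1 : σ < 1 / 2) :
    0 < ((σ : ℂ) + (τ : ℂ) * Complex.I).re ∧ ((σ : ℂ) + (τ : ℂ) * Complex.I) ≠ 1 / 2 := by
  refine ⟨by simp [h0], fun h => ?_⟩
  have := congrArg Complex.re h
  simp at this
  linarith

/-- **`UnitCircleCrossedOnce` in operator language** (item 1470): the crux is equivalently the
statement that no continuous selection `Λ` of NONZERO EIGENVALUES OF MAYER'S `L_{σ+iτ}` ON `B(D)`
over `[a, b] ⊂ (0, 1/2)`, `|τ| ≥ 7`, has modulus `1` at both endpoints. [folklore] -/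
theorem mayerPairing_unitCircleCrossedOnce_iff_operator :
    UnitCircleCrossedOnce ↔
      ∀ τ : ℝ, 7 ≤ |τ| → ∀ a b : ℝ, 0 < a → a < b → b < 1 / 2 → ∀ Λ : ℝ → ℂ,
        ContinuousOn Λ (Set.Icc a b) →
        (∀ σ ∈ Set.Icc a b, Λ σ ≠ 0 ∧ ∃ g : MayerSpace, g ≠ 0 ∧
          mayerTransfer ((σ : ℂ) + (τ : ℂ) * Complex.I) g = Λ σ • g) →
        ¬ (‖Λ a‖ = 1 ∧ ‖Λ b‖ = 1) := by
  constructor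
  · intro hU τ hτ a b ha hab hb Λ hΛ hop
    refine hU τ hτ a b ha hab hb Λ hΛ fun σ hσ => ?_
    obtain ⟨hs, hs'⟩ := mayerPairing_param_ok (σ := σ) (τ := τ) (ha.trans_le hσ.1) (hσ.2.trans_lt hb)
    exact (mayerPairing_isEigen_iff hs hs').2 (hop σ hσ)
  · intro hop τ hτ a b ha hab hb Λ hΛ heig
    refine hop τ hτ a b ha hab hb Λ hΛ fun σ hσ => ?_
    obtain ⟨hs, hs'⟩ := mayerPairing_param_ok (σ := σ) (τ := τ) (ha.trans_le hσ.1) (hσ.2.trans_lt hb)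
    exact (mayerPairing_isEigen_iff hs hs').1 (heig σ hσ)

/-- **`BranchPairing` in operator language** (item 1471): for every zero `ρ` of `ζ` with
`0 < Re ρ ≤ 1/2`, `Im ρ > 14`, a continuous selection of NONZERO EIGENVALUES OF `L_{σ + i Im ρ/2}`
ON `B(D)` over `[Re ρ/2, (1 - Re ρ)/2]` equal to `1` at both ends. [folklore] -/
theorem mayerPairing_branchPairing_iff_operator :
    BranchPairing ↔
      ∀ ρ : ℂ, riemannZeta ρ = 0 → 0 < ρ.re → ρ.re ≤ 1 / 2 → 14 < ρ.im → ∃ Λ : ℝ → ℂ,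
        ContinuousOn Λ (Set.Icc (ρ.re / 2) ((1 - ρ.re) / 2)) ∧ Λ (ρ.re / 2) = 1 ∧
        Λ ((1 - ρ.re) / 2) = 1 ∧
        ∀ σ ∈ Set.Icc (ρ.re / 2) ((1 - ρ.re) / 2), Λ σ ≠ 0 ∧ ∃ g : MayerSpace, g ≠ 0 ∧
          mayerTransfer ((σ : ℂ) + ((ρ.im / 2 : ℝ) : ℂ) * Complex.I) g = Λ σ • g := by
  constructor
  · intro hB ρ hζ h0 hhalf h14
    obtain ⟨Λ, hΛ, h1, h2, heig⟩ := hB ρ hζ h0 hhalf h14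
    refine ⟨Λ, hΛ, h1, h2, fun σ hσ => ?_⟩
    obtain ⟨hs, hs'⟩ := mayerPairing_param_ok (σ := σ) (τ := ρ.im / 2) (by linarith [hσ.1])
      (by linarith [hσ.2])
    exact (mayerPairing_isEigen_iff hs hs').1 (heig σ hσ)
  · intro hop ρ hζ h0 hhalf h14
    obtain ⟨Λ, hΛ, h1, h2, heig⟩ := hop ρ hζ h0 hhalf h14
    refine ⟨Λ, hΛ, h1, h2, fun σ hσ => ?_⟩
    obtain ⟨hs, hs'⟩ := mayerPairing_param_ok (σ := σ) (τ := ρ.im / 2) (by linarith [hσ.1])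
      (by linarith [hσ.2])
    exact (mayerPairing_isEigen_iff hs hs').2 (heig σ hσ)

/-- **The target in operator language** (item 1473): `Target` is, verbatim up to the predicate
audit, the conjunction of the two operator statements above about the nonzero point spectrum of
Mayer's `L_s` on `B(D)`. [folklore] -/
theorem mayerPairing_target_iff_operator :
    Target ↔
      ((∀ τ : ℝ, 7 ≤ |τ| → ∀ a b : ℝ, 0 < a → a < b → b < 1 / 2 → ∀ Λ : ℝ → ℂ,
        ContinuousOn Λ (Set.Icc a b) →
        (∀ σ ∈ Set.Icc a b, Λ σ ≠ 0 ∧ ∃ g : MayerSpace, g ≠ 0 ∧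
          mayerTransfer ((σ : ℂ) + (τ : ℂ) * Complex.I) g = Λ σ • g) →
        ¬ (‖Λ a‖ = 1 ∧ ‖Λ b‖ = 1)) ∧
      (∀ ρ : ℂ, riemannZeta ρ = 0 → 0 < ρ.re → ρ.re ≤ 1 / 2 → 14 < ρ.im → ∃ Λ : ℝ → ℂ,
        ContinuousOn Λ (Set.Icc (ρ.re / 2) ((1 - ρ.re) / 2)) ∧ Λ (ρ.re / 2) = 1 ∧
        Λ ((1 - ρ.re) / 2) = 1 ∧
        ∀ σ ∈ Set.Icc (ρ.re / 2) ((1 - ρ.re) / 2), Λ σ ≠ 0 ∧ ∃ g : MayerSpace, g ≠ 0 ∧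
          mayerTransfer ((σ : ℂ) + ((ρ.im / 2 : ℝ) : ℂ) * Complex.I) g = Λ σ • g)) :=
  (show Target ↔ UnitCircleCrossedOnce ∧ BranchPairing from Iff.rfl).trans
    (and_congr mayerPairing_unitCircleCrossedOnce_iff_operator mayerPairing_branchPairing_iff_operator)

end Summit.RiemannHypothesis.RiemannHypothesis.Theorems
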